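import Summits.BirchSwinnertonDyer.BirchSwinnertonDyer.Theorems.ByReductionTypeAtTwoOrdKatoHalfAtTwoIsoZetaColemanMuDefs
import HarnessLib

/-!
# Route ByReductionTypeAtTwo, crux `OrdKatoHalfAtTwoIso` (stmt-BirchSwinnertonDyer-19573), child B8
# `OrdKatoIntSurjectiveAtTwo` (stmt-BirchSwinnertonDyer-23762): B8 BY NAME from two SIGN-FREE readings — Kato's zeta
# classes in Coleman coordinates at `2` and the core Theorem A at `2` WITHOUT `Δ < 0` (the latter = (H-K) without
# `Δ < 0` by the companion file `…CoreSignFreeOfKolyvagin`, T1 and the sign-free H-C being PROVED)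

Seat `cruxlead-stmt-BirchSwinnertonDyer-19573-w2` (prover WIDTH under the LEAD cruxlead-19573 g4, line
`steinberg-fibre-at-two`; HOME `run/shared/lean/pub/bsd-2adic/`; `--supports` stmt-BirchSwinnertonDyer-23762). HONEST FRAMING
(cell bsd-2adic): BSD is not proved by any of this; neither the crux nor the child B8 is proved here. THEOREMS ONLY — the
sign-free statements are written INLINE as hypotheses (no definition, no named fact, no `sorry`); every theorem that
mentions B8, the crux, the residue binder or `μ = 0` is CONDITIONAL on the displayed hypotheses it names; whether the
planner/lead names them as constants is their call.

THE RE-CUT OF B8 (kernel, this file). The lead's chain (p678187) «re-cut socket 2 (`HasZetaColemanMuInputsAtTwo`, per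
datum) + socket 1 (`coreTheoremATwoResidue_holds`) + socket 3 (analytic `μ₂ = 0`, PROVED for `ρ̄₂` onto) ⇒
`μ(X(E/ℚ_∞)) = 0` ⇒ (Abbes–Ullmo, Kato 17.4 (1)(2)) Kato's lower divisibility AT `W`» uses the sign `Δ_W < 0` at ONE
place only: socket 1. Socket 1 = T1 (`SelmerSideTwo`, PROVED, sign-free) + Ω1 (H-C; PROVED sign-free for the cyclotomic
tower at a good `2` by this seat, p681540 `chebotarevTransposition_two_of_good_two`) + Ω2 (H-K `KolyvaginRankOneTwo`, whose
`Δ < 0` serves only the real place in Step 4: `H¹(ℝ, 𝒯_J(E)) = 0` iff complex conjugation is odd on `E[2]` iff `Δ < 0`).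
Hence, with

* **(ZCμ-sf)** `hZ` — `HasZetaColemanMuInputsAtTwo` for every globally minimal `W`, good ordinary at `2`, `ρ̄_{W,2}`
  onto (NO sign, NO `2`-adic image hypothesis), newform `f`, cyclotomic `(κ, γ)`, all `D`, `Y` = the body of the lead's
  `ZetaColemanMuInputsNegDiscAtTwo` (p678187) with `W.Δ < 0 →` deleted (Kato §§12–17 at `2` do not see the sign);
* **(CoreA-sf)** `hcore` — the body of `CoreTheoremATwoResidue` (p655368) with `W.Δ < 0 →` deleted;
* **(H-K-sf)** `hK` — the body of `KolyvaginRankOneTwo` (p658966) with `W.Δ < 0 →` deleted,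

the companion file `…CoreSignFreeOfKolyvagin` proves `coreTheoremATwo_signFree_of_kolyvagin_signFree : hK → CoreA-sf`
(KERNEL: T1 p663770 + sign-free H-C p681540 + the count), and this file proves: §2 `μ(D.X) = 0` per datum from
`HasZetaColemanMuInputsAtTwo` + CoreA-sf (the lead's bookkeeping p678187 with the socket-1 call replaced); §3 the
∀-forms on the SIGN-FREE habitat «good ordinary at `2`, `ρ̄₂` onto» (`KatoMuPartAtTwo`, `MainConjectureLowerDivisibility…`
with Abbes–Ullmo BY NAME and Kato 17.4 (1)(2) at `2`); §4 BY NAME: **B8 `KatoIntAtGoodOrdSurjectiveTwo` from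
hZ + hcore (+ AU + 17.4 (1)(2))**; the residue binder; and **the crux `OrdKatoHalfAtTwoIso` from
hZ + hcore + AU + B7 + 17.4 (1)(2) — WITHOUT B8**; §5 the sign-free readings imply the registered ones (monotonicity).
So B8's beyond-print content on its `0 < Δ` half is EXACTLY {ZCμ-sf on `0 < Δ`, H-K at the real place} — the kernel
form of MEMO-6's `c_∞ = 2` (tree Selmer groups are STRICT at the infinite places, `selmerGroupOver`, Greenberg's
convention, so `μ = 0` is the right target there).

References: [Kato2004Asterisque] Thm 12.6, (14.9.3), 16.6, 17.4, 17.11, §17.13; [MazurRubin2004] Prop 1.3.2, §3;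
[AbbesUllmo1996] Thm A; [GreenbergLNM1716] Conj 1.11; [MazurTateTeitelbaum1986Invent] §I.12; MEMO-5′/MEMO-6 (HOME); the
line's files p655368, p658966, p663770, p669276, p678187, p678698, p681344, p681540.
-/

set_option autoImplicit false
set_option linter.dupNamespace false

noncomputable section

open scoped Classical MatrixGroups ModularForm NumberField
open CongruenceSubgroup WeierstrassCurve Field IsDedekindDomain NumberField
open Literature.NumberTheory.GaloisRepresentations
open Literature.NumberTheory.GaloisCohomology
open Literature.NumberTheory.EllipticCurves Literature.NumberTheory.EllipticCurves.ModularForms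
open Literature.NumberTheory.EllipticCurves.Kato2004
  Literature.NumberTheory.EllipticCurves.Kato2004.EulerSystemValues
open Literature.NumberTheory.EllipticCurves.Rank1Residual
open Summit.BirchSwinnertonDyer.BirchSwinnertonDyer.Theorems.Rank1ResidualX1Defs
  Summit.BirchSwinnertonDyer.BirchSwinnertonDyer.Rank1Residual
  Summit.BirchSwinnertonDyer.BirchSwinnertonDyer.Rank1Residual.CoreAssembly
open Summit.BirchSwinnertonDyer.Rank1Residual Summit.BirchSwinnertonDyer.Rank1Residual.X5
open Summit.BirchSwinnertonDyer.BirchSwinnertonDyer.Theorems.OrdKatoOptimalAtTwo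
  Summit.BirchSwinnertonDyer.BirchSwinnertonDyer.Theorems.OrdKatoIntAtTwo
open Summit.BirchSwinnertonDyer.BirchSwinnertonDyer.Theses.ByReductionTypeAtTwo

namespace Summit.BirchSwinnertonDyer.BirchSwinnertonDyer.Theorems.SteinbergFibreAtTwo


/-! ## §2 Per datum: `μ(X) = 0` from the zeta classes in Coleman coordinates and the sign-free core Theorem A -/

section CoreSignFree

variable (hcore : ∀ (W : WeierstrassCurve ℚ) [W.IsElliptic] [W.IsGloballyMinimal]
      [ContinuousSMul ℤ_[2] (W.tateModule 2)] [Module.Free ℤ_[2] (W.tateModule 2)]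
      [Module.Finite ℤ_[2] (W.tateModule 2)]
      (κ : ZpExtension ℚ 2) (γ : absoluteGaloisGroup ℚ) (I : IwasawaH1Data W 2 κ γ)
      (hκ : κ.IsCyclotomic),
      W.HasGoodReductionAtPrime 2 → ¬ (2 : ℤ) ∣ W.frobeniusTrace 2 →
      W.HasSurjectiveModNGaloisRep 2 → κ.IsTopGenerator γ →
      (∃ s : I.H, IsEulerSystemClassTwo W hκ I s ∧
        s ∉ IwasawaAlgebra.augIdealP 2 • (⊤ : Submodule (IwasawaAlgebra 2) I.H)) →
      ∃ J : ℕ, ∀ y : Literature.NumberTheory.EllipticCurves.subgroupH1 κ.kerSubgroup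
          (WeierstrassCurve.geomTorsion W (2 : ℤ)),
        W.torsionToPrimaryH1Sub 2 κ.kerSubgroup y ∈ W.fineSelmerInfty κ →
          (⇑(Literature.NumberTheory.EllipticCurves.conjH1 κ.kerSubgroup
              (WeierstrassCurve.geomTorsion W (2 : ℤ)) γ -
            AddMonoidHom.id (Literature.NumberTheory.EllipticCurves.subgroupH1 κ.kerSubgroup
              (WeierstrassCurve.geomTorsion W (2 : ℤ)))))^[J] y = 0)

section PerDatum

variable {W : WeierstrassCurve ℚ} [W.IsElliptic] [W.IsGloballyMinimal]
  [ContinuousSMul ℤ_[2] (W.tateModule 2)] [Module.Free ℤ_[2] (W.tateModule 2)]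
  [Module.Finite ℤ_[2] (W.tateModule 2)] {N : ℕ} {f : CuspForm (Gamma0 N) 2}
  {κ : ZpExtension ℚ 2} {γ : absoluteGaloisGroup ℚ} {hκ : κ.IsCyclotomic}
  {D : W.SelmerDualData κ γ} {Y : W.FineSelmerDualData κ γ}

include hcore in
/-- **`μ(X(E/ℚ_∞)) = 0` from Kato's zeta classes in Coleman coordinates at `2` and the SIGN-FREE core Theorem A**
(KERNEL modulo the two displayed readings), for `W` good ordinary at `2` with `ρ̄_{W,2}` onto — NO sign of `Δ`, no
`2`-adic image hypothesis. Verbatim the lead's bookkeeping `mu_eq_zero_of_hasZetaColemanMuInputsAtTwo` (p678187: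
INT2-AUTO → socket 3 PROVED → image clause at `(2)` → span clause → a GENUINE class `∉ 2𝐇¹` → socket 1 →
`length_(2) X₀ = 0 = length_(2) X`), with the socket-1 call served by `hcore` instead of `coreTheoremATwoResidue_holds`.
[cite: Kato2004Asterisque, Thm. 12.6 (p. 222), (14.9.3) (p. 240), §17.13 (pp. 279–280)]
[cite: MazurTateTeitelbaum1986Invent, §I.12] -/
theorem mu_eq_zero_of_hasZetaColemanMuInputsAtTwo_of_core_signFree [NeZero N] (hgo : GoodOrd W 2)
    (h2 : W.HasSurjectiveModNGaloisRep 2) (hf : IsNewformOf W f)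
    (hγ : κ.IsTopGenerator γ) (h : HasZetaColemanMuInputsAtTwo W f κ γ hκ D Y) : D.mu = 0 := by
  have hord : IsOrdinaryAt W 2 := ⟨hgo.1, hgo.2⟩
  haveI : NeZero ((2 : ℕ) : ℚ) := ⟨by norm_num⟩
  -- `X(E/ℚ_∞)` is finitely generated over `Λ` for the cyclotomic `κ` (PROVED in the tree, Nakayama)
  haveI : Module.Finite (IwasawaAlgebra 2) D.X :=
    WeierstrassCurve.SelmerDualData.module_finite_of_isCyclotomic W κ hκ D hγ
  obtain ⟨I, Z, P, ℓ, τ, π, hZ, hτℓ, hπs, hπ, himg⟩ := h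
  haveI : Module.Finite (IwasawaAlgebra 2) Y.X := Module.Finite.of_surjective π hπs
  -- `L₂(f, α) ∈ ι(Λ)` (INT2-AUTO, PROVED) and socket 3 (PROVED): `G₁ ∉ (2)`
  obtain ⟨G₁, hG₁⟩ := exists_iwasawaToPowerSeries_eq_padicLFunction_two_auto (W := W) (f := f) hord hf
  have hμL : G₁ ∉ IwasawaAlgebra.augIdealP 2 :=
    not_mem_augIdealP_of_norm_coeff_eq_one hG₁
      (AnalyticMuTwo.exists_norm_coeff_padicLFunction_two_eq_one_of_surj W hgo h2 hf)
  -- the image clause at `(2)`: `s ∉ (2)`, `s·G₁ ∈ ℓ(Z)`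
  obtain ⟨s, hs, hsG⟩ := himg G₁ hG₁
  -- hence some zeta class `z ∈ Z` is not divisible by `2` in `𝐇¹` …
  have hz : ∃ z ∈ Z, z ∉ IwasawaAlgebra.augIdealP 2 • (⊤ : Submodule (IwasawaAlgebra 2) I.H) := by
    by_contra hcon
    push Not at hcon
    have hZle : Z ≤ IwasawaAlgebra.augIdealP 2 • (⊤ : Submodule (IwasawaAlgebra 2) I.H) :=
      fun z hz => hcon z hz
    have hsub : Submodule.map (P.subtype ∘ₗ ℓ) Z ≤
        (IwasawaAlgebra.augIdealP 2 • ⊤ : Submodule (IwasawaAlgebra 2) (IwasawaAlgebra 2)) :=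
      (Submodule.map_mono hZle).trans
        (by rw [Submodule.map_smul'']; exact Submodule.smul_mono le_rfl le_top)
    have htop : (IwasawaAlgebra.augIdealP 2 • ⊤ : Submodule (IwasawaAlgebra 2) (IwasawaAlgebra 2)) =
        IwasawaAlgebra.augIdealP 2 := by
      rw [Ideal.smul_eq_mul, Ideal.mul_top]
    have hsG' : s * G₁ ∈ IwasawaAlgebra.augIdealP 2 := by rw [← htop]; exact hsub hsG
    rcases (IwasawaAlgebra.isPrime_augIdealP_holds 2).mem_or_mem hsG' with h' | h'
    · exact hs h'
    · exact hμL h'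
  obtain ⟨z, hzZ, hz2⟩ := hz
  -- … and by the span clause some GENUINE `2`-adic Euler-system class is not divisible by `2`
  obtain ⟨s', hs', hs'p⟩ := exists_mem_not_mem_of_le_span hZ hzZ hz2
  -- socket 1 SIGN-FREE (displayed): a power of `T` kills the `E[2]`-lifts of `Sel₀`
  obtain ⟨J, hJ⟩ := hcore W κ γ I hκ hgo.1 hgo.2 h2 hγ ⟨s', hs', hs'p⟩
  haveI : Finite (Y.X ⧸ (IwasawaAlgebra.augIdealP 2 • (⊤ : Submodule (IwasawaAlgebra 2) Y.X))) :=
    Y.finite_quotient_augIdealP_of_finite_pTorsion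
      (W.finite_fineSelmerInfty_pTorsion_of_forall_iterate_eq_zero κ hγ hJ)
  -- bookkeeping at `𝔭 = (2)`
  let 𝔭 : PrimeSpectrum (IwasawaAlgebra 2) :=
    ⟨IwasawaAlgebra.augIdealP 2, IwasawaAlgebra.isPrime_augIdealP_holds 2⟩
  have hY0 : Module.lengthAt (IwasawaAlgebra 2) Y.X 𝔭 = 0 :=
    KatoMuSkeleton.lengthAt_eq_zero_of_finite_quotient_p (M := Y.X) 𝔭 rfl
  have hX0 : Module.lengthAt (IwasawaAlgebra 2) D.X 𝔭 = 0 := by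
    set LZ : Submodule (IwasawaAlgebra 2) P := Submodule.map ℓ Z with hLZ
    set M : Ideal (IwasawaAlgebra 2) := Submodule.map P.subtype LZ with hM
    have hM_eq : Submodule.map (P.subtype ∘ₗ ℓ) Z = M := by
      rw [hM, hLZ, Submodule.map_comp]
    have hsGM : s * G₁ ∈ M := hM_eq ▸ hsG
    have hnot : ¬ M ≤ 𝔭.asIdeal := fun hle => by
      rcases 𝔭.isPrime.mem_or_mem (hle hsGM) with h' | h'
      · exact hs h'
      · exact hμL h'
    have hΛM : Module.lengthAt (IwasawaAlgebra 2) (IwasawaAlgebra 2 ⧸ M) 𝔭 = 0 :=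
      Module.lengthAt_quotient_eq_zero_of_not_le hnot
    have hPLZ : Module.lengthAt (IwasawaAlgebra 2) (P ⧸ LZ) 𝔭 = 0 := by
      refine le_antisymm ?_ bot_le
      rw [← hΛM]
      refine Module.lengthAt_le_of_injective (Submodule.mapQ LZ M P.subtype fun y hy => ⟨y, hy, rfl⟩) ?_ 𝔭
      rw [← LinearMap.ker_eq_bot, Submodule.ker_mapQ, hM,
        Submodule.comap_map_eq_of_injective P.injective_subtype, Submodule.mkQ_map_self]
    have hle : LZ ≤ LinearMap.ker τ := by
      rintro _ ⟨x, hx, rfl⟩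
      exact hτℓ x hx
    let f' : (P ⧸ LZ) →ₗ[IwasawaAlgebra 2] D.X := LZ.liftQ τ hle
    have hf' : Function.Exact f' π := by
      rw [LinearMap.exact_iff, Submodule.range_liftQ]
      exact LinearMap.exact_iff.mp hπ
    refine le_antisymm ?_ bot_le
    calc Module.lengthAt (IwasawaAlgebra 2) D.X 𝔭
        ≤ Module.lengthAt (IwasawaAlgebra 2) (P ⧸ LZ) 𝔭 + Module.lengthAt (IwasawaAlgebra 2) Y.X 𝔭 :=
          Module.lengthAt_le_add_of_exact f' π hf' 𝔭
      _ = 0 := by rw [hPLZ, hY0, zero_add]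
  change muInvariant 2 D.X = 0
  rw [muInvariant_eq_toNat_lengthAt 2 D.X 𝔭 rfl, hX0]
  rfl

end PerDatum

/-! ## §3 The ∀-forms on the SIGN-FREE habitat «good ordinary at `2`, `ρ̄₂` onto» -/

section Habitat

variable (hZ : ∀ (W : WeierstrassCurve ℚ) [W.IsElliptic] [W.IsGloballyMinimal]
    [ContinuousSMul ℤ_[2] (W.tateModule 2)] [Module.Free ℤ_[2] (W.tateModule 2)]
    [Module.Finite ℤ_[2] (W.tateModule 2)] {N : ℕ} [NeZero N] (f : CuspForm (Gamma0 N) 2)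
    (κ : ZpExtension ℚ 2) (γ : absoluteGaloisGroup ℚ) (hκ : κ.IsCyclotomic),
    IsOrdinaryAt W 2 → W.HasSurjectiveModNGaloisRep 2 →
    κ.IsTopGenerator γ → IsCyclotomicVariable 2 γ → IsNewformOf W f →
    ∀ (D : W.SelmerDualData κ γ) (Y : W.FineSelmerDualData κ γ),
      HasZetaColemanMuInputsAtTwo W f κ γ hκ D Y)

variable (W : WeierstrassCurve ℚ) [W.IsElliptic] [W.IsGloballyMinimal]

include hZ hcore in
/-- **`μ(X(E/ℚ_∞)) = 0` for every cyclotomic Selmer dual datum, modulo the two sign-free readings `hZ` (zeta classes in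
Coleman coordinates at `2`, the body of `ZetaColemanMuInputsNegDiscAtTwo` without `W.Δ < 0`) and `hcore` (core Theorem A
at `2` without `W.Δ < 0`)**, for every globally minimal `W`, good ordinary at `2`, `ρ̄_{W,2}` onto — BOTH signs of `Δ`,
surjective `2`-adic image or not — and every newform `f` of it. [cite: Kato2004Asterisque, §17.13 (pp. 279–280)]
[cite: GreenbergLNM1716, Conj. 1.11 (p. 64) (shape)] -/
theorem mu_eq_zero_of_zetaColemanMu_signFree_of_core_signFree
    (hgo : GoodOrd W 2) (h2 : W.HasSurjectiveModNGaloisRep 2)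
    {N : ℕ} [NeZero N] (f : CuspForm (Gamma0 N) 2) (hf : IsNewformOf W f)
    (κ : ZpExtension ℚ 2) (γ : absoluteGaloisGroup ℚ) (hκ : κ.IsCyclotomic) (hγ : κ.IsTopGenerator γ)
    (hγ' : IsCyclotomicVariable 2 γ) (D : W.SelmerDualData κ γ) : D.mu = 0 := by
  haveI : ContinuousSMul ℤ_[2] (W.tateModule 2) := TateModule.continuousSMul_padicInt
  haveI : Module.Free ℤ_[2] (W.tateModule 2) := W.module_free_tateModule_holds 2
  haveI : Module.Finite ℤ_[2] (W.tateModule 2) := W.module_finite_tateModule_holds 2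
  obtain ⟨Y⟩ := W.nonempty_fineSelmerDualData κ hγ
  exact mu_eq_zero_of_hasZetaColemanMuInputsAtTwo_of_core_signFree hcore hgo h2 hf hγ
    (hZ W f κ γ hκ ⟨hgo.1, hgo.2⟩ h2 hγ hγ' hf D Y)

include hZ hcore in
/-- **`O1.KatoMuPartAtTwo W` on the sign-free habitat modulo the two sign-free readings** (`μ = 0` ⇒
`2^{μ(X)} = 1 ∣ L₀`). [cite: GreenbergLNM1716, Conj. 1.11 (p. 64) (shape)] -/
theorem katoMuPartAtTwo_of_zetaColemanMu_signFree_of_core_signFree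
    (hgo : GoodOrd W 2) (h2 : W.HasSurjectiveModNGaloisRep 2) : O1.KatoMuPartAtTwo W := by
  intro κ γ hκ hγ hγ' _ _ f hf ϖ _ D L₀ _
  rw [mu_eq_zero_of_zetaColemanMu_signFree_of_core_signFree hcore hZ W hgo h2 f hf κ γ hκ hγ hγ' D, pow_zero,
    map_one]
  exact one_dvd _

include hZ hcore in
/-- **Kato's lower divisibility `X5.O1.MainConjectureLowerDivisibilityAtTwoOrd W` AT the curve on the whole SIGN-FREE
habitat «good ordinary at `2`, `ρ̄₂` onto»**, modulo the two sign-free readings, Abbes–Ullmo BY NAME (`ord₂ ϖ = 0` on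
the `E[2]`-irreducible good locus, p654400) and Kato 17.4 (1)(2) at `2` for `W` (`h17`, PRINT) — through the cell's
`O1.mainConjectureLowerDivisibilityAtTwoOrd_of_katoMuPartAtTwo`.
[cite: Kato2004Asterisque, Thm. 17.4 (1)(2) (p. 273)] [cite: AbbesUllmo1996, Thm. A] -/
theorem mainConjectureLowerDivisibilityAtTwoOrd_of_zetaColemanMu_signFree_of_core_signFree
    (hAU : abbesUllmo_not_dvd_maninConstant_of_not_dvd_level)
    (hgo : GoodOrd W 2) (h2 : W.HasSurjectiveModNGaloisRep 2)
    (h17 : ∀ [NeZero (W.conductorNorm ℤ)] (f : CuspForm (Gamma0 (W.conductorNorm ℤ)) 2),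
      kato_divisibility_allPrimes W 2 (f := f)) :
    O1.MainConjectureLowerDivisibilityAtTwoOrd W := by
  haveI : NeZero ((2 : ℕ) : ℚ) := ⟨by norm_num⟩
  exact O1.mainConjectureLowerDivisibilityAtTwoOrd_of_katoMuPartAtTwo W h17
    (fun f hf ϖ hϖ => hint_two_of_abbesUllmo_of_irr hAU W hgo
      (hasIrreducibleModPGaloisRep_of_hasSurjectiveModNGaloisRep W 2 h2) f hf ϖ hϖ)
    (katoMuPartAtTwo_of_zetaColemanMu_signFree_of_core_signFree hcore hZ W hgo h2)

end Habitat

/-! ## §4 BY NAME: B8, the residue binder, and the crux — from the two sign-free readings -/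

section ByName

variable (hZ : ∀ (W : WeierstrassCurve ℚ) [W.IsElliptic] [W.IsGloballyMinimal]
    [ContinuousSMul ℤ_[2] (W.tateModule 2)] [Module.Free ℤ_[2] (W.tateModule 2)]
    [Module.Finite ℤ_[2] (W.tateModule 2)] {N : ℕ} [NeZero N] (f : CuspForm (Gamma0 N) 2)
    (κ : ZpExtension ℚ 2) (γ : absoluteGaloisGroup ℚ) (hκ : κ.IsCyclotomic),
    IsOrdinaryAt W 2 → W.HasSurjectiveModNGaloisRep 2 →
    κ.IsTopGenerator γ → IsCyclotomicVariable 2 γ → IsNewformOf W f →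
    ∀ (D : W.SelmerDualData κ γ) (Y : W.FineSelmerDualData κ γ),
      HasZetaColemanMuInputsAtTwo W f κ γ hκ D Y)

include hZ hcore in
/-- **B8 = child stmt-BirchSwinnertonDyer-23762 `KatoIntAtGoodOrdSurjectiveTwo` BY NAME from the two sign-free readings**,
Abbes–Ullmo BY NAME and Kato 17.4 (1)(2) at `2` (`h17`): for every globally minimal `W`, good ordinary at `2`, with
`ρ_{W,2^∞}` onto (so `ρ̄₂` onto), Kato's lower divisibility AT `W` — BOTH halves `Δ < 0` (already the lead's p678187) and
`0 < Δ` (new: served by the sign-free core, i.e. by H-K at the real place, §1). CONDITIONAL; B8 is NOT proved.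
[cite: Kato2004Asterisque, Thm. 17.4 (1)(2) (p. 273)] [cite: AbbesUllmo1996, Thm. A] -/
theorem katoIntAtGoodOrdSurjectiveTwo_of_zetaColemanMu_signFree_of_core_signFree
    (hAU : abbesUllmo_not_dvd_maninConstant_of_not_dvd_level)
    (h17 : ∀ (V : WeierstrassCurve ℚ) [V.IsElliptic] [V.IsGloballyMinimal] [NeZero (V.conductorNorm ℤ)]
      (f : CuspForm (Gamma0 (V.conductorNorm ℤ)) 2), kato_divisibility_allPrimes V 2 (f := f)) :
    KatoIntAtGoodOrdSurjectiveTwo := by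
  intro W _ _ hgo him
  have h2 : W.HasSurjectiveModNGaloisRep 2 := by
    have h := him 1 one_pos
    rwa [pow_one] at h
  exact mainConjectureLowerDivisibilityAtTwoOrd_of_zetaColemanMu_signFree_of_core_signFree hcore hZ W hAU hgo h2
    (h17 W)

include hZ hcore in
/-- **The residue binder `OrdKatoHalfDD12ResidueTwo` from the two sign-free readings** (the residue `ρ̄₂` onto ∧
`ρ_{2^∞}` not onto is inside the sign-free habitat; no Dokchitser–Dokchitser needed).
[cite: Kato2004Asterisque, Thm. 17.4 (1)(2) (p. 273)] [cite: AbbesUllmo1996, Thm. A] -/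
theorem ordKatoHalfDD12ResidueTwo_of_zetaColemanMu_signFree_of_core_signFree
    (hAU : abbesUllmo_not_dvd_maninConstant_of_not_dvd_level)
    (h17 : ∀ (V : WeierstrassCurve ℚ) [V.IsElliptic] [V.IsGloballyMinimal] [NeZero (V.conductorNorm ℤ)]
      (f : CuspForm (Gamma0 (V.conductorNorm ℤ)) 2), kato_divisibility_allPrimes V 2 (f := f)) :
    OrdKatoHalfDD12ResidueTwo := by
  intro W _ _ _ hgo h2 _
  exact mainConjectureLowerDivisibilityAtTwoOrd_of_zetaColemanMu_signFree_of_core_signFree hcore hZ W hAU hgo h2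
    (h17 W)

include hZ hcore in
/-- **The crux `OrdKatoHalfAtTwoIso` (stmt-BirchSwinnertonDyer-19573) BY NAME from the two sign-free readings, Abbes–Ullmo,
B7 and Kato 17.4 (1)(2) at `2` — WITHOUT B8** (which §4 derives from the same readings): one application of the cell's
door `ordKatoHalfAtTwoIso_of_binders`. CONDITIONAL on the displayed hypotheses; nothing closed.
[cite: Kato2004Asterisque, Thm. 17.4 (1)(2) (p. 273)] [cite: AbbesUllmo1996, Thm. A] -/
theorem ordKatoHalfAtTwoIso_of_zetaColemanMu_signFree_of_core_signFree
    (hAU : abbesUllmo_not_dvd_maninConstant_of_not_dvd_level)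
    (hB7 : KatoMuPartAtOptimalMemberOfNotSurjectiveTwo)
    (h17 : ∀ (V : WeierstrassCurve ℚ) [V.IsElliptic] [V.IsGloballyMinimal] [NeZero (V.conductorNorm ℤ)]
      (f : CuspForm (Gamma0 (V.conductorNorm ℤ)) 2), kato_divisibility_allPrimes V 2 (f := f)) :
    OrdKatoHalfAtTwoIso :=
  ordKatoHalfAtTwoIso_of_binders hB7
    (katoIntAtGoodOrdSurjectiveTwo_of_zetaColemanMu_signFree_of_core_signFree hcore hZ hAU h17)
    (ordKatoHalfDD12ResidueTwo_of_zetaColemanMu_signFree_of_core_signFree hcore hZ hAU h17) h17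

end ByName

end CoreSignFree

/-! ## §5 Monotonicity: the sign-free readings imply the registered ones -/

/-- The sign-free zeta-class reading implies the lead's registered `ZetaColemanMuInputsNegDiscAtTwo` (drop `Δ < 0`).
[folklore] -/
theorem zetaColemanMuInputsNegDiscAtTwo_of_signFree
    (hZ : ∀ (W : WeierstrassCurve ℚ) [W.IsElliptic] [W.IsGloballyMinimal]
      [ContinuousSMul ℤ_[2] (W.tateModule 2)] [Module.Free ℤ_[2] (W.tateModule 2)]
      [Module.Finite ℤ_[2] (W.tateModule 2)] {N : ℕ} [NeZero N] (f : CuspForm (Gamma0 N) 2)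
      (κ : ZpExtension ℚ 2) (γ : absoluteGaloisGroup ℚ) (hκ : κ.IsCyclotomic),
      IsOrdinaryAt W 2 → W.HasSurjectiveModNGaloisRep 2 →
      κ.IsTopGenerator γ → IsCyclotomicVariable 2 γ → IsNewformOf W f →
      ∀ (D : W.SelmerDualData κ γ) (Y : W.FineSelmerDualData κ γ),
        HasZetaColemanMuInputsAtTwo W f κ γ hκ D Y) :
    ZetaColemanMuInputsNegDiscAtTwo := by
  intro W _ _ _ _ _ N _ f κ γ hκ hord h2 _ hγ hγ' hf D Y
  exact hZ W f κ γ hκ hord h2 hγ hγ' hf D Y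

/-- The sign-free core Theorem A implies the registered socket 1 `CoreTheoremATwoResidue` (drop `Δ < 0`). [folklore] -/
theorem coreTheoremATwoResidue_of_core_signFree
    (hcore : ∀ (W : WeierstrassCurve ℚ) [W.IsElliptic] [W.IsGloballyMinimal]
      [ContinuousSMul ℤ_[2] (W.tateModule 2)] [Module.Free ℤ_[2] (W.tateModule 2)]
      [Module.Finite ℤ_[2] (W.tateModule 2)]
      (κ : ZpExtension ℚ 2) (γ : absoluteGaloisGroup ℚ) (I : IwasawaH1Data W 2 κ γ)
      (hκ : κ.IsCyclotomic),
      W.HasGoodReductionAtPrime 2 → ¬ (2 : ℤ) ∣ W.frobeniusTrace 2 →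
      W.HasSurjectiveModNGaloisRep 2 → κ.IsTopGenerator γ →
      (∃ s : I.H, IsEulerSystemClassTwo W hκ I s ∧
        s ∉ IwasawaAlgebra.augIdealP 2 • (⊤ : Submodule (IwasawaAlgebra 2) I.H)) →
      ∃ J : ℕ, ∀ y : Literature.NumberTheory.EllipticCurves.subgroupH1 κ.kerSubgroup
          (WeierstrassCurve.geomTorsion W (2 : ℤ)),
        W.torsionToPrimaryH1Sub 2 κ.kerSubgroup y ∈ W.fineSelmerInfty κ →
          (⇑(Literature.NumberTheory.EllipticCurves.conjH1 κ.kerSubgroup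
              (WeierstrassCurve.geomTorsion W (2 : ℤ)) γ -
            AddMonoidHom.id (Literature.NumberTheory.EllipticCurves.subgroupH1 κ.kerSubgroup
              (WeierstrassCurve.geomTorsion W (2 : ℤ)))))^[J] y = 0) :
    CoreTheoremATwoResidue := by
  intro W _ _ _ _ _ κ γ I hκ hgood hord h2 _ hγ hs
  exact hcore W κ γ I hκ hgood hord h2 hγ hs

end Summit.BirchSwinnertonDyer.BirchSwinnertonDyer.Theorems.SteinbergFibreAtTwo

end
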